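import Summits.BirchSwinnertonDyer.Rank2.ToyRankThreeLocalRootNumbers
import Summits.BirchSwinnertonDyer.Rank2.ToyRankThreeKatoInputsAtTwo
import Literature.NumberTheory.EllipticCurves.PAdicLFunctionZeroAtMinusTwoProofs
import Literature.NumberTheory.EllipticCurves.BSDRootNumberOddParityProofs
import HarnessLib

/-!
# The toy curve `E₀ = [1, 4, 0, 105, 0]`: `−∏ w_v = −1`, conductor `675255`, `w(E₀) = w(E₀^{(2)}) = −1`
# under modularity, hence the toy's analytic-certificate clause (ii) `T + 2 ∣ g` is a THEOREM and
# `corank_{ℤ₂} Sel_{2^∞}(E₀/ℚ) = ord_{T=0} L₂(E₀, T) = 3` holds modulo {Kato at 2, Modularity, ONE λ-certificate}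

Cell `bsd-rank2`, seat `bsd-rank2-eng-2` GEN 4; companion of `Rank2/ToyRankThreeLocalRootNumbers.lean`,
`Rank2/ToyRankThreeOrderEqualityAtTwo.lean`, `Rank2/ToyRankThreeKatoInputsAtTwo.lean` (BC5 toy of the T-r3₂
door, planner p2 G14 memo `PADIC-R2-G14.md` §4.4 clause (ii); director-bsd 2026-08-27T04:43:36Z (5)).

* `toy_localRootNumberAt` — `w_v(E₀) = −1` iff the prime below `v` is `59` or `109`, else `+1`;
  `toy_algebraicRootNumber : −∏ᶠ_v w_v(E₀) = −1` (the finite product is `w_{59} w_{109} = 1`).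
* `toy_conductorNorm : N(E₀) = 675255` (`f_v = 1` at the five multiplicative places, `0` elsewhere).
* `toy_rootNumber (hmod) : w(E₀) = −1` — squarefree conductor ⇒ `w = −∏ w_v` from the Modularity Theorem
  (tree `rootNumber_eq_algebraicRootNumber_of_squarefree`, Kellock–Dokchitser / Atkin–Lehner).
* `toy_rootNumber_quadraticTwist_two (hmod) : w(E₀^{(2)}) = −1` — lit GEN 15's `rootNumber_quadraticTwist_two`:
  `w(E^{(2)}) = χ₈(N) w(E)`, `N = 675255 ≡ 7 (mod 8)`, `χ₈(7) = 1`; hence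
  `toy_analyticRank_quadraticTwist_two_ne_zero (hmod)` (`odd_analyticRank_of_rootNumber_eq_neg_one`).
* `toy_zeroAtMinusTwo (hmod)` — clause (ii) of the toy certificate is a THEOREM: for every newform `f` of
  `E₀` and every integral multiple `g = c · L₂(f, α₂; T)`, `T + 2 ∣ g` (lit GEN 15's
  `X_add_C_two_dvd_of_analyticRank_quadraticTwist_two_ne_zero`: MTT interpolation at `χ₈`).
* **`toy_selmerCorank_eq_order_eq_three_of_lambdaCert`** — `corank_{ℤ₂} Sel_{2^∞}(E₀/ℚ) = 3` and
  `ord_{T=0} L₂(f, α₂; T) = 3` from the NAMED facts Kato 18.4 at `2` (all curves) and Modularity, plus the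
  ONE remaining finite input: a `λ`-CERTIFICATE «some nonzero integral multiple of `L₂(f, α₂; T)` has a unit
  coefficient in degree `≤ 4`» (numerically `λ = 4`, `μ = 0`, kit j265726 of p2 G13; not certified in the tree).

THEOREMS ONLY (no definition, no named fact, no `sorry`). PARTITION: none — r_an ≥ 2, summit axis S0;
TWIN (D-0056): n/a. B1 honesty: a single explicit curve; root numbers enter ONLY as the sign forcing the
exact zero `L₂(E₀, −2) = 0`; the corank/order statement is conditional on two published theorems (named) and
one displayed finite computation; no Mordell–Weil rank `3`, no S0 motion.

References: D. Rohrlich, *Compositio Math.* 87 (1993) Prop. 2 [Rohrlich1993Compositio]; L. Cowland Kellock,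
V. Dokchitser, *Bull. LMS* 55 (2023) Cor. 2.5 [KellockDokchitser2023]; B. Mazur, J. Tate, J. Teitelbaum,
*Invent. Math.* 84 (1986) §I.14 [MazurTateTeitelbaum1986Invent]; K. Kato, *Astérisque* 295 (2004) Thm. 18.4
[Kato2004Asterisque]; J. H. Silverman, *ATAEC* (1994) IV.10.2 [Silverman1994].
-/

set_option linter.dupNamespace false

noncomputable section

open IsDedekindDomain IsDedekindDomain.HeightOneSpectrum WeierstrassCurve Polynomial
  Rat.HeightOneSpectrum Literature.NumberTheory.EllipticCurves
  Literature.NumberTheory.EllipticCurves.ModularForms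

namespace Summit.BirchSwinnertonDyer.Rank2

/-! ### §1 The local root numbers assembled; the algebraic root number -/

/-- **The local root numbers of `E₀`**: `−1` above `59` and `109` (split multiplicative), `+1` at every
other finite place (good, or non-split multiplicative above `3, 5, 7`). [cite: Rohrlich1993Compositio, Prop. 2] -/
theorem toy_localRootNumberAt (v : HeightOneSpectrum ℤ) :
    (⟨1, 4, 0, 105, 0⟩ : WeierstrassCurve ℚ).localRootNumberAt v =
      if natGenerator v = 59 ∨ natGenerator v = 109 then -1 else 1 := by
  rcases (WeierstrassCurve.valuation_Δ_le_one_of_isIntegralAt (toy_isIntegralAt v)).eq_or_lt with h | h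
  · -- good place: the prime below `v` does not divide `Δ`
    have hgood := toy_localRootNumberAt_of_good h
    have hnd : ¬ (natGenerator v = 59 ∨ natGenerator v = 109) := by
      rw [toy_Δ, show (-70901775 : ℚ) = ((-70901775 : ℤ) : ℚ) by norm_num,
        Literature.NumberTheory.EllipticCurves.Rat.valuation_intCast_eq_one_iff] at h
      rintro (hp | hp) <;> rw [hp] at h <;> norm_num at h
    rw [if_neg hnd]; exact hgood
  · rcases toy_natGenerator_mem h with hp | hp | hp | hp | hp
    · rw [if_neg (by omega)]; exact toy_localRootNumberAt_of_not_split h (Or.inl hp)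
    · rw [if_neg (by omega)]; exact toy_localRootNumberAt_of_not_split h (Or.inr (Or.inl hp))
    · rw [if_neg (by omega)]; exact toy_localRootNumberAt_of_not_split h (Or.inr (Or.inr hp))
    · rw [if_pos (Or.inl hp)]; exact toy_localRootNumberAt_of_split h (Or.inl hp)
    · rw [if_pos (Or.inr hp)]; exact toy_localRootNumberAt_of_split h (Or.inr hp)

/-- **The algebraic root number of `E₀` is `−1`**: `−∏ᶠ_v w_v(E₀) = −(w₅₉ · w₁₀₉) = −((−1)(−1)) = −1`.
[cite: Rohrlich1993Compositio, Prop. 2] -/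
theorem toy_algebraicRootNumber : (⟨1, 4, 0, 105, 0⟩ : WeierstrassCurve ℚ).algebraicRootNumber = -1 := by
  classical
  -- a place of `ℤ` is determined by the prime below it (cf. `BCDT.eq_primesEquiv_symm_of_natGenerator_eq`)
  have key : ∀ (v : HeightOneSpectrum ℤ) {p : ℕ} (hp : p.Prime), natGenerator v = p →
      v = (primesEquiv (R := ℤ)).symm ⟨p, hp⟩ := fun v p hp hv ↦ by
    apply (primesEquiv (R := ℤ)).injective
    rw [Equiv.apply_symm_apply]
    exact Subtype.ext hv
  have h59 : Nat.Prime 59 := by norm_num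
  have h109 : Nat.Prime 109 := by norm_num
  set v₁ : HeightOneSpectrum ℤ := (primesEquiv (R := ℤ)).symm ⟨59, h59⟩ with hv₁
  set v₂ : HeightOneSpectrum ℤ := (primesEquiv (R := ℤ)).symm ⟨109, h109⟩ with hv₂
  have hg₁ : natGenerator v₁ = 59 := Literature.NumberTheory.EllipticCurves.Rat.natGenerator_primesEquiv_symm ⟨59, h59⟩
  have hg₂ : natGenerator v₂ = 109 :=
    Literature.NumberTheory.EllipticCurves.Rat.natGenerator_primesEquiv_symm ⟨109, h109⟩
  have hne : v₁ ≠ v₂ := by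
    intro heq
    have := congrArg natGenerator heq
    rw [hg₁, hg₂] at this
    norm_num at this
  have hsupp : (Function.mulSupport fun v : HeightOneSpectrum ℤ ↦
      (⟨1, 4, 0, 105, 0⟩ : WeierstrassCurve ℚ).localRootNumberAt v) ⊆ (({v₁, v₂} : Finset _) : Set _) := by
    intro v hv
    rw [Function.mem_mulSupport, toy_localRootNumberAt] at hv
    by_cases hc : natGenerator v = 59 ∨ natGenerator v = 109
    · simp only [Finset.coe_insert, Finset.coe_singleton, Set.mem_insert_iff, Set.mem_singleton_iff]
      rcases hc with hc | hc
      · exact Or.inl (key v h59 hc)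
      · exact Or.inr (key v h109 hc)
    · rw [if_neg hc] at hv; exact absurd rfl hv
  rw [WeierstrassCurve.algebraicRootNumber, finprod_eq_prod_of_mulSupport_subset _ hsupp,
    Finset.prod_pair hne, toy_localRootNumberAt, toy_localRootNumberAt, if_pos (Or.inl hg₁),
    if_pos (Or.inr hg₂)]
  norm_num

/-! ### §2 The conductor `N(E₀) = 675255 = 3·5·7·59·109` -/

/-- **The conductor of `E₀` is `675255`** (`f_v = 1` at the multiplicative places above `3, 5, 7, 59, 109`,
`f_v = 0` at the good places; Silverman *ATAEC* IV.10.2). [cite: Silverman1994, IV.10.2] -/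
theorem toy_conductorNorm : (⟨1, 4, 0, 105, 0⟩ : WeierstrassCurve ℚ).conductorNorm ℤ = 675255 := by
  haveI := toy_isElliptic
  set E : WeierstrassCurve ℚ := ⟨1, 4, 0, 105, 0⟩ with hE
  have h3 : Nat.Prime 3 := by norm_num
  have h5 : Nat.Prime 5 := by norm_num
  have h7 : Nat.Prime 7 := by norm_num
  have h59 : Nat.Prime 59 := by norm_num
  have h109 : Nat.Prime 109 := by norm_num
  have hfac : ∀ p : ℕ, p.Prime → (675255 : ℕ).factorization p =
      if p = 3 ∨ p = 5 ∨ p = 7 ∨ p = 59 ∨ p = 109 then 1 else 0 := by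
    intro p hp
    rw [show (675255 : ℕ) = 3 * (5 * (7 * (59 * 109))) by norm_num,
      Nat.factorization_mul (by norm_num) (by norm_num), Nat.factorization_mul (by norm_num) (by norm_num),
      Nat.factorization_mul (by norm_num) (by norm_num), Nat.factorization_mul (by norm_num) (by norm_num)]
    simp only [Finsupp.coe_add, Pi.add_apply, h3.factorization, h5.factorization, h7.factorization,
      h59.factorization, h109.factorization, Finsupp.single_apply]
    by_cases e3 : p = 3
    · subst e3; norm_num
    by_cases e5 : p = 5
    · subst e5; norm_num
    by_cases e7 : p = 7
    · subst e7; norm_num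
    by_cases e59 : p = 59
    · subst e59; norm_num
    by_cases e109 : p = 109
    · subst e109; norm_num
    simp [Ne.symm e3, Ne.symm e5, Ne.symm e7, Ne.symm e59, Ne.symm e109, e3, e5, e7, e59, e109]
  refine Nat.eq_of_factorization_eq (E.conductorNorm_pos_holds).ne' (by norm_num) fun p => ?_
  by_cases hp : p.Prime
  swap
  · rw [Nat.factorization_eq_zero_of_not_prime _ hp, Nat.factorization_eq_zero_of_not_prime _ hp]
  rw [show p = ((⟨p, hp⟩ : Nat.Primes) : ℕ) from rfl, factorization_conductorNorm_primesEquiv_symm, hfac p hp]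
  set v := (primesEquiv (R := ℤ)).symm ⟨p, hp⟩ with hv
  have hgen : natGenerator v = p :=
    Literature.NumberTheory.EllipticCurves.Rat.natGenerator_primesEquiv_symm ⟨p, hp⟩
  by_cases hbad : p = 3 ∨ p = 5 ∨ p = 7 ∨ p = 59 ∨ p = 109
  · -- a multiplicative place: `f_v = 1`
    have hΔ : v.valuation ℚ E.Δ < 1 := by
      rw [toy_Δ, show (-70901775 : ℚ) = ((-70901775 : ℤ) : ℚ) by norm_num,
        Literature.NumberTheory.EllipticCurves.Rat.valuation_intCast_lt_one_iff, hgen]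
      rcases hbad with hp' | hp' | hp' | hp' | hp' <;> rw [hp'] <;> norm_num
    rw [(conductorExponent_eq_one_iff_holds v E).mpr (toy_hasMultiplicativeReductionAt hΔ), if_pos hbad]
  · -- a good place: `f_v = 0`
    have hΔ : v.valuation ℚ E.Δ = 1 := by
      rw [toy_Δ, show (-70901775 : ℚ) = ((-70901775 : ℤ) : ℚ) by norm_num,
        Literature.NumberTheory.EllipticCurves.Rat.valuation_intCast_eq_one_iff, hgen, Int.dvd_neg]
      intro hd
      exact hbad (prime_dvd_toyΔ hp (by exact_mod_cast hd))
    rw [(conductorExponent_eq_zero_iff_holds v E).mpr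
      (hasGoodReductionAt_of_valuation_Δ_eq_one_holds v E (toy_isIntegralAt v) hΔ), if_neg hbad]

/-! ### §3 The analytic root numbers of `E₀` and `E₀^{(2)}` under the Modularity Theorem -/

/-- **`w(E₀) = −1` from the Modularity Theorem** (squarefree conductor: `w = −∏_v w_v`, Atkin–Lehner /
Kellock–Dokchitser, tree `rootNumber_eq_algebraicRootNumber_of_squarefree`). [cite: KellockDokchitser2023, Cor. 2.5] -/
theorem toy_rootNumber (hmod : exists_isNewformOf) :
    (⟨1, 4, 0, 105, 0⟩ : WeierstrassCurve ℚ).rootNumber = -1 := by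
  haveI := toy_isElliptic
  have hRA : (⟨1, 4, 0, 105, 0⟩ : WeierstrassCurve ℚ).rootNumber_eq_algebraicRootNumber :=
    WeierstrassCurve.rootNumber_eq_algebraicRootNumber_of_squarefree _ toy_squarefree_conductorNorm hmod
  have hadd : ∀ v : HeightOneSpectrum ℤ, (⟨1, 4, 0, 105, 0⟩ : WeierstrassCurve ℚ).HasAdditiveReductionAt v →
      3 < ringChar (ℤ ⧸ v.asIdeal) := fun v h ↦ (toy_not_hasAdditiveReductionAt v h).elim
  rw [hRA hadd, toy_algebraicRootNumber]

/-- **`w(E₀^{(2)}) = −1`** for the quadratic twist by `2`: `w(E^{(2)}) = χ₈(N) w(E)` for `E` good at `2`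
with odd conductor (tree `rootNumber_quadraticTwist_two`), `N(E₀) = 675255 ≡ 7 (mod 8)`, `χ₈(7) = 1`.
[cite: KellockDokchitser2023, Cor. 2.5] -/
theorem toy_rootNumber_quadraticTwist_two (hmod : exists_isNewformOf) :
    ((⟨1, 4, 0, 105, 0⟩ : WeierstrassCurve ℚ).quadraticTwist 2).rootNumber = -1 := by
  haveI := toy_isElliptic
  have hN2 : ¬ 2 ∣ (⟨1, 4, 0, 105, 0⟩ : WeierstrassCurve ℚ).conductorNorm ℤ := by
    rw [toy_conductorNorm]; norm_num
  have hgood := hasGoodReductionAt_of_natGenerator_eq_two (W := ⟨1, 4, 0, 105, 0⟩)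
    toy_hasGoodReductionAtPrime_two
  have htw := (WeierstrassCurve.rootNumber_quadraticTwist_two (⟨1, 4, 0, 105, 0⟩ : WeierstrassCurve ℚ)
    hmod hN2 hgood).1
  rw [htw, toy_conductorNorm, toy_rootNumber hmod]
  decide

/-- `E₀^{(2)}` is an elliptic curve. [folklore] -/
theorem toy_quadraticTwist_two_isElliptic :
    ((⟨1, 4, 0, 105, 0⟩ : WeierstrassCurve ℚ).quadraticTwist 2).IsElliptic :=
  haveI := toy_isElliptic
  WeierstrassCurve.isElliptic_quadraticTwist _ two_ne_zero

/-- **`ord_{s=1} L(E₀^{(2)}, s) ≠ 0`** (odd, the sign being `−1`: Silverman *AEC* C.16, unconditional given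
the sign). [cite: SilvermanAEC2009, C.16 Thm. 16.3 and remark] -/
theorem toy_analyticRank_quadraticTwist_two_ne_zero (hmod : exists_isNewformOf) :
    ((⟨1, 4, 0, 105, 0⟩ : WeierstrassCurve ℚ).quadraticTwist 2).analyticRank ≠ 0 := by
  haveI := toy_quadraticTwist_two_isElliptic
  have hodd := odd_analyticRank_of_rootNumber_eq_neg_one (toy_rootNumber_quadraticTwist_two hmod)
  intro h0
  rw [h0] at hodd
  exact Nat.not_odd_zero hodd

/-! ### §4 Clause (ii) of the toy certificate is a theorem; the toy modulo ONE λ-certificate -/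

/-- **Clause (ii) of the toy's analytic certificate is a THEOREM** (modulo Modularity): for every
global-minimality witness, every newform `f` of `E₀`, and every `g ∈ ℤ₂⟦T⟧`, `c ∈ ℚ₂` with
`g = c · L₂(f, α₂; T)`: `T + 2 ∣ g` — Mazur–Tate–Teitelbaum interpolation at `χ₈` (`T = −2`) and
`L(E₀^{(2)}, 1) = 0` (lit GEN 15's `X_add_C_two_dvd_of_analyticRank_quadraticTwist_two_ne_zero`), with
`E₀` good ordinary at `2` (`toy_isOrdinaryAt_two`). [cite: MazurTateTeitelbaum1986Invent, §I.14 Proposition (p. 20)] -/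
theorem toy_zeroAtMinusTwo (hmod : exists_isNewformOf)
    (hmin : (⟨1, 4, 0, 105, 0⟩ : WeierstrassCurve ℚ).IsGloballyMinimal) ⦃N : ℕ⦄ [NeZero N]
    (f : CuspForm (CongruenceSubgroup.Gamma0 N) 2) (hf : IsNewformOf (⟨1, 4, 0, 105, 0⟩ : WeierstrassCurve ℚ) f)
    (c : ℚ_[2]) (g : PowerSeries ℤ_[2])
    (hg : g.map (PadicInt.Coe.ringHom (p := 2)) =
      PowerSeries.C c * padicLFunction f (@unitRoot (⟨1, 4, 0, 105, 0⟩ : WeierstrassCurve ℚ) hmin 2 _ : ℚ_[2])) :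
    (PowerSeries.X + PowerSeries.C (2 : ℤ_[2])) ∣ g :=
  haveI := toy_isElliptic
  X_add_C_two_dvd_of_analyticRank_quadraticTwist_two_ne_zero (toy_isOrdinaryAt_two hmin) hf
    (toy_analyticRank_quadraticTwist_two_ne_zero hmod) hg

/-- **The toy modulo ONE `λ`-certificate.** For the rank-three curve `E₀ = [1, 4, 0, 105, 0]` (conductor
`675255`): from the NAMED facts Kato 2004 Thm. 18.4 at `p = 2` (`hKato`, for every globally minimal elliptic
curve and newform) and the Modularity Theorem (`hmod`, `exists_isNewformOf`), and ONE finite `2`-adic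
`λ`-certificate (`hlam`: for every newform `f` of `E₀`, some nonzero `ℚ₂`-multiple `g ∈ ℤ₂⟦T⟧` of
`L₂(f, α₂; T)` has a unit coefficient in degree `≤ 4`; numerically `λ = 4, μ = 0`, kit j265726 — not
certified in the tree): `corank_{ℤ₂} Sel_{2^∞}(E₀/ℚ) = 3` and `ord_{T=0} L₂(f, α₂; T) = 3` for every
newform `f` of `E₀`. Everything else — `E₀` elliptic, globally minimal, good ordinary at `2`,
`rank E₀(ℚ) ≥ 3`, `w(E₀) = w(E₀^{(2)}) = −1`, the zero at `T = −2` — is PROVED in the tree.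
[cite: Kato2004Asterisque, Thm. 18.4] [cite: MazurTateTeitelbaum1986Invent, §I.14] -/
theorem toy_selmerCorank_eq_order_eq_three_of_lambdaCert
    (hKato : ∀ (W : WeierstrassCurve ℚ) [W.IsElliptic] [W.IsGloballyMinimal] ⦃N : ℕ⦄ [NeZero N]
      (f : CuspForm (CongruenceSubgroup.Gamma0 N) 2),
      kato_selmerCorank_le_order_padicLFunction_allPrimes W 2 (f := f))
    (hmod : exists_isNewformOf)
    (hlam : ∀ (hmin : (⟨1, 4, 0, 105, 0⟩ : WeierstrassCurve ℚ).IsGloballyMinimal) ⦃N : ℕ⦄ [NeZero N]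
      (f : CuspForm (CongruenceSubgroup.Gamma0 N) 2),
      IsNewformOf (⟨1, 4, 0, 105, 0⟩ : WeierstrassCurve ℚ) f →
        ∃ (c : ℚ_[2]) (g : PowerSeries ℤ_[2]), c ≠ 0 ∧
          g.map (PadicInt.Coe.ringHom (p := 2)) =
            PowerSeries.C c * padicLFunction f
              (@unitRoot (⟨1, 4, 0, 105, 0⟩ : WeierstrassCurve ℚ) hmin 2 _ : ℚ_[2]) ∧
          ∃ i ≤ 4, IsUnit (PowerSeries.coeff i g)) :
    (⟨1, 4, 0, 105, 0⟩ : WeierstrassCurve ℚ).selmerCorank 2 = 3 ∧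
      ∀ (hmin : (⟨1, 4, 0, 105, 0⟩ : WeierstrassCurve ℚ).IsGloballyMinimal) ⦃N : ℕ⦄ [NeZero N]
        (f : CuspForm (CongruenceSubgroup.Gamma0 N) 2),
        IsNewformOf (⟨1, 4, 0, 105, 0⟩ : WeierstrassCurve ℚ) f →
          (padicLFunction f
            (@unitRoot (⟨1, 4, 0, 105, 0⟩ : WeierstrassCurve ℚ) hmin 2 _ : ℚ_[2])).order = 3 :=
  toy_selmerCorank_eq_order_eq_three_of_facts hKato hmod fun hmin N _ f hf ↦ by
    obtain ⟨c, g, hc, hg, hi⟩ := hlam hmin f hf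
    exact ⟨c, g, hc, hg, toy_zeroAtMinusTwo hmod hmin f hf c g hg, hi⟩

end Summit.BirchSwinnertonDyer.Rank2

end
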